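import Summits.QuantumFields.YangMills.Theorems.SmallFieldWideningLargeFieldMassRefinementTailGaussianRung
import Summits.QuantumFields.YangMills.Theorems.AlphaInputsT3ACv3LinearLiftSpread
import HarnessLib

/-!
# `AlphaInputsT3ACv3LinearLiftFlux` — «FLUX-LIFT»: THE EXACT FINE LIFT OF THE REFERENCE ABELIAN FLUX CONNECTION (one file, def-free) — cell `ym3-torus`,
# width seat `ym-ust-20520-w5` (g8), line «SYM-CENTRE» (EX cure (ii-a), ★★OWNER RULING g28-№7), line pen px20 g2's «FLUX-LIFT GO» 2026-08-28T22:30Z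

WHY.  The symmetric regular representative of a REDUCIBLE small-field fibre (px20 LOCATE #56, row (R4)) is built from the angles `θ_V` of the diagonalised coarse field:
`curl θ_V = φ + 2π·m` with `φ` small and `m` an INTEGER 2-cocycle whose class `[m] ∈ H²(T^d;ℤ)` (the abelian FLUX SECTOR) may be non-zero for legitimate members (uniform
flux `2π/N²` through a coordinate 2-torus is `< ε₁` on large tori).  The Lipschitz exact lift ✓`exists_smoothExactLift_torus` (px19 g3) handles the SMALL REAL part only; spreading the
integer part would destroy the plaquette clause.  THIS FILE supplies, for every direction pair `μ ≠ ν` and every charge `q ∈ ℤ`, an EXPLICIT fine one-form `w` (uniform flux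
`q/M²` per `(μν)`-plaquette plus ONE Dirac column) together with its `k`-fold (0.4)-linear average `W := linAvgIter k w`, and proves that BOTH curls are in STANDARD FORM:
`curl_{μν} = q·(1/M_j² − E⁽ʲ⁾_{μν})`, `E⁽ʲ⁾_{μν}(x) = [x_μ = −1 ∧ x_ν = −1]` (one defect plaquette per `(μν)`-layer), all other curl components zero.  Consequently (R4) subtracts
`2π·Σ q_{μν} W_{μν}` upstairs (leaving a SMALL REAL curl `φ + 2πq/N²` for the Lipschitz lift) and adds `2π·Σ q_{μν} w_{μν}` downstairs (integer defect — invisible in `e^{ia}` —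
plus a CONSTANT `2πq/M²`, Lipschitz row `0`), with EXACT averages throughout (`W` is the average of `w` BY DEFINITION — no segment-mean or coboundary bookkeeping).
THE ONE LATTICE FACT (§2): `L` consecutive fine coordinates starting inside the block of `y_μ` hit `−1` exactly `[y_μ = −1]` times; hence every transported `L × L` square of the
exact Stokes formula ✓`curlAt_linAvg04_eq_sum` contains exactly `E⁽ʲ⁺¹⁾_{μν}(y)` defect plaquettes, for EVERY offset — so the standard form REPRODUCES ITSELF one level up with
`c ↦ L²c` (§3), and iterates (§4).  §5 is the explicit level-`0` cochain; §6 the packaged ★★★`exists_fluxLift`.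
WHAT IS NOT HERE.  The INTEGER class decomposition `m = Σ q_{μν}E_{μν} + δs` on the discrete torus («ZCLASS», flagged on the bus), the diagonal exponentiation and `RegPr`
(R4-DICT, px19), the assembly `hSymCentre_of_reducible` (px20).  Count-neutral helper (`--supports stmt-QuantumFields-19200 --as helper`); registry, binders and every landed file
untouched.  YM₃ on the torus is a RUNG (R3) of the programme, not the Clay problem; no claim about d = 4, infinite volume or a mass gap; nothing of the stub ∕ crux is claimed.

References: T. Bałaban, Commun. Math. Phys. 109 (1987) 249–301 [Balaban1987RG1] ((0.4) p.253, (0.11) p.253: the linear average and its iteration); Commun. Math. Phys. 98 (1985) 17–51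
[Balaban1985Averaging] ((9), (14) p.19: lattice curl and the block Stokes bound); Commun. Math. Phys. 102 (1985) 277–309 [Balaban1985Variational] ((6) p.278: the regularity clauses served).
-/

set_option autoImplicit false

noncomputable section

namespace Summit.QuantumFields.YangMills.Theorems.LinearLiftFlux

open scoped BigOperators
open Finset
open Literature.MathematicalPhysics.QuantumFieldTheory.Balaban1983to89
open Literature.MathematicalPhysics.QuantumFieldTheory.Balaban1983to89.BlockAveraging (off Idx)
open Literature.MathematicalPhysics.QuantumFieldTheory.Balaban1983to89.B10Eq47AxialChi (shiftN shiftN_zero shiftN_succ)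
open Literature.MathematicalPhysics.QuantumFieldTheory.Balaban1983to89.BlockAveragingEMLProp2 (shiftN_apply walkEnd_stairWord_apply)
open Summit.QuantumFields.YangMills.Theorems.AbelianEML
open Summit.QuantumFields.YangMills.Theorems.SFWGaussianRung (curlAt_linAvg04_eq_sum)
open Summit.QuantumFields.YangMills.Theorems.LinearLiftProfile (side)
open Summit.QuantumFields.YangMills.Theorems.LinearLiftSpread (hh hside hN)

variable {P : Params} {j : ℕ}

/-! ## §1 `ZMod` bookkeeping: the last residue `−1` -/

/-- `z = −1` in `ZMod M` iff its label is `M − 1`. [folklore] -/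
theorem eq_neg_one_iff_val (z : ZMod (P.sitesPerDir j)) : z = -1 ↔ z.val = P.sitesPerDir j - 1 := by
  have hM := P.one_lt_sitesPerDir j
  have hneg : (((P.sitesPerDir j - 1 : ℕ)) : ZMod (P.sitesPerDir j)) = -1 := by
    rw [Nat.cast_sub hM.le, Nat.cast_one, ZMod.natCast_self, zero_sub]
  constructor
  · intro hz
    rw [← hneg] at hz
    rw [hz, ZMod.val_natCast, Nat.mod_eq_of_lt (by omega)]
  · intro hv
    rw [← ZMod.natCast_zmod_val z, hv, hneg]

/-- The label of `z + 1`: `0` after the last residue, `z.val + 1` otherwise. [folklore] -/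
theorem val_add_one_eq (z : ZMod (P.sitesPerDir j)) : (z + 1).val = if z = -1 then 0 else z.val + 1 := by
  have hM := P.one_lt_sitesPerDir j
  have hz := ZMod.val_lt z
  split_ifs with h
  · rw [h, neg_add_cancel, ZMod.val_zero]
  · rw [eq_neg_one_iff_val] at h
    rw [ZMod.val_add, ZMod.val_one, Nat.mod_eq_of_lt (by omega)]

/-- A natural label `n` with `n + 1 < 2M` reads `−1` in `ZMod M` iff `n + 1 = M`. [folklore] -/
theorem natCast_eq_neg_one_iff {n : ℕ} (hn : n + 1 < 2 * P.sitesPerDir j) :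
    ((n : ℕ) : ZMod (P.sitesPerDir j)) = -1 ↔ n + 1 = P.sitesPerDir j := by
  have hM := P.one_lt_sitesPerDir j
  rw [eq_neg_iff_add_eq_zero, ← Nat.cast_one, ← Nat.cast_add, CharP.cast_eq_zero_iff (ZMod (P.sitesPerDir j)) (P.sitesPerDir j)]
  constructor
  · rintro ⟨c, hc⟩
    have hc2 : c < 2 := by
      by_contra h
      have h2 : 2 ≤ c := by omega
      have := Nat.mul_le_mul_left (P.sitesPerDir j) h2
      omega
    interval_cases c <;> omega
  · intro h; rw [h]

/-! ## §2 The one lattice fact: a run of `L` fine coordinates inside block `y_μ` hits `−1` exactly `[y_μ = −1]` times -/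

/-- The `μ`-coordinate of the offset point `emb y + n_r` is the natural label `y_μ·L + r_μ` (standing range). [cite: Balaban1987RG1, (0.3) p.252] -/
theorem offPt_apply_eq (hj : j + 1 ≤ P.m + P.K) (y : Site P (j + 1)) (r : Fin P.d → Fin P.L) (μ : Fin P.d) :
    offPt y (off r) μ = (((y μ).val * P.L + (r μ : ℕ) : ℕ) : ZMod (P.sitesPerDir j)) := by
  unfold offPt
  rw [walkEnd_stairWord_apply]
  have he : (emb y μ : ZMod (P.sitesPerDir j)) = ((((y μ).val * P.L + (P.L - 1) / 2 : ℕ)) : ZMod (P.sitesPerDir j)) := by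
    rw [← ZMod.natCast_zmod_val (emb y μ), Site.val_emb hj]
  have ho : ((off r μ : ℤ) : ZMod (P.sitesPerDir j)) = ((r μ : ℕ) : ZMod (P.sitesPerDir j)) - ((((P.L - 1) / 2 : ℕ)) : ZMod (P.sitesPerDir j)) := by
    simp only [off, Int.cast_sub, Int.cast_natCast]
  rw [he, ho]
  push_cast
  ring

/-- **THE RUN COUNT**: `Σ_{s<L} [ (emb y + n_r)_μ + s = −1 ] = [ y_μ = −1 ]` — among the `L` consecutive fine labels `y_μL + r_μ + s` the last residue `M_j − 1 = M_{j+1}L − 1` occurs iff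
`y_μ = M_{j+1} − 1`, and then exactly once (`s = L − 1 − r_μ`). [cite: Balaban1987RG1, (0.1) p.252] -/
theorem sum_indicator_run (hj : j + 1 ≤ P.m + P.K) (y : Site P (j + 1)) (r : Fin P.d → Fin P.L) (μ : Fin P.d) :
    ∑ s : Fin P.L, (if offPt y (off r) μ + ((s : ℕ) : ZMod (P.sitesPerDir j)) = -1 then (1 : ℝ) else 0) = if y μ = -1 then 1 else 0 := by
  have hL := P.hL.2
  have hMs : P.sitesPerDir j = P.sitesPerDir (j + 1) * P.L := P.sitesPerDir_eq_mul_succ hj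
  have hM1 := P.one_lt_sitesPerDir (j + 1)
  have hy : (y μ).val < P.sitesPerDir (j + 1) := ZMod.val_lt _
  have hr : (r μ : ℕ) < P.L := (r μ).isLt
  -- the product `y_μ·L` and `M_{j+1}·L` as atoms for linear arithmetic
  have hyL : (y μ).val * P.L + P.L ≤ P.sitesPerDir (j + 1) * P.L := by
    have := Nat.mul_le_mul_right P.L (Nat.succ_le_of_lt hy); rw [Nat.succ_mul] at this; exact this
  have hcond : ∀ s : Fin P.L, (offPt y (off r) μ + ((s : ℕ) : ZMod (P.sitesPerDir j)) = -1) ↔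
      ((y μ).val * P.L + (r μ : ℕ) + s + 1 = P.sitesPerDir j) := by
    intro s
    have hs := s.isLt
    rw [offPt_apply_eq hj, ← Nat.cast_add, natCast_eq_neg_one_iff]
    rw [hMs]; omega
  simp_rw [hcond]
  by_cases hyμ : y μ = -1
  · rw [if_pos hyμ]
    have hv : (y μ).val = P.sitesPerDir (j + 1) - 1 := (eq_neg_one_iff_val _).mp hyμ
    have hvL : (y μ).val * P.L + P.L = P.sitesPerDir (j + 1) * P.L := by
      rw [hv, Nat.sub_mul, one_mul]; have := Nat.mul_le_mul_right P.L hM1.le; omega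
    -- the unique solution `s₀ = L − 1 − r_μ`
    let s₀ : Fin P.L := ⟨P.L - 1 - (r μ : ℕ), by omega⟩
    have hiff : ∀ s : Fin P.L, ((y μ).val * P.L + (r μ : ℕ) + s + 1 = P.sitesPerDir j) ↔ s = s₀ := by
      intro s
      rw [Fin.ext_iff]
      show _ ↔ (s : ℕ) = P.L - 1 - (r μ : ℕ)
      rw [hMs]; have hs := s.isLt; omega
    simp_rw [hiff]
    rw [Finset.sum_ite_eq']; simp
  · rw [if_neg hyμ]
    have hv : (y μ).val ≠ P.sitesPerDir (j + 1) - 1 := fun h => hyμ ((eq_neg_one_iff_val _).mpr h)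
    have hvL : (y μ).val * P.L + P.L + P.L ≤ P.sitesPerDir (j + 1) * P.L := by
      have h2 : (y μ).val + 2 ≤ P.sitesPerDir (j + 1) := by omega
      have := Nat.mul_le_mul_right P.L h2
      rw [Nat.add_mul] at this; omega
    refine Finset.sum_eq_zero fun s _ => ?_
    rw [if_neg]
    rw [hMs]; have hs := s.isLt; omega

/-- **THE SQUARE COUNT**: every transported `L × L` square of block `y` contains exactly `[y_μ = −1]·[y_ν = −1]` defect plaquettes (`μ ≠ ν`; for EVERY offset `r`).
[cite: Balaban1985Averaging, (14) p.19] -/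
theorem sum_sq_defect (hj : j + 1 ≤ P.m + P.K) (y : Site P (j + 1)) (r : Fin P.d → Fin P.L) {μ ν : Fin P.d} (hμν : μ ≠ ν) :
    ∑ t : Fin P.L, ∑ s : Fin P.L,
        (if shiftN (shiftN (offPt y (off r)) ν (t : ℕ)) μ (s : ℕ) μ = -1 ∧ shiftN (shiftN (offPt y (off r)) ν (t : ℕ)) μ (s : ℕ) ν = -1 then (1 : ℝ) else 0) =
      if y μ = -1 ∧ y ν = -1 then 1 else 0 := by
  -- coordinates of the square's plaquettes
  have hcμ : ∀ t s : Fin P.L, shiftN (shiftN (offPt y (off r)) ν (t : ℕ)) μ (s : ℕ) μ = offPt y (off r) μ + ((s : ℕ) : ZMod (P.sitesPerDir j)) := by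
    intro t s; rw [shiftN_apply, shiftN_apply, if_pos rfl, if_neg hμν, add_zero]
  have hcν : ∀ t s : Fin P.L, shiftN (shiftN (offPt y (off r)) ν (t : ℕ)) μ (s : ℕ) ν = offPt y (off r) ν + ((t : ℕ) : ZMod (P.sitesPerDir j)) := by
    intro t s; rw [shiftN_apply, shiftN_apply, if_neg (Ne.symm hμν), if_pos rfl, add_zero]
  simp_rw [hcμ, hcν]
  -- the indicator of a conjunction is the product of the indicators; the double sum factorises
  have e : ∀ t s : Fin P.L,
      (if offPt y (off r) μ + ((s : ℕ) : ZMod (P.sitesPerDir j)) = -1 ∧ offPt y (off r) ν + ((t : ℕ) : ZMod (P.sitesPerDir j)) = -1 then (1 : ℝ) else 0) =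
        (if offPt y (off r) ν + ((t : ℕ) : ZMod (P.sitesPerDir j)) = -1 then (1 : ℝ) else 0) *
          (if offPt y (off r) μ + ((s : ℕ) : ZMod (P.sitesPerDir j)) = -1 then (1 : ℝ) else 0) := by
    intro t s
    by_cases h1 : offPt y (off r) ν + ((t : ℕ) : ZMod (P.sitesPerDir j)) = -1 <;>
      by_cases h2 : offPt y (off r) μ + ((s : ℕ) : ZMod (P.sitesPerDir j)) = -1 <;> simp [h1, h2]
  simp_rw [e]
  rw [← Finset.sum_mul_sum, sum_indicator_run hj y r ν, sum_indicator_run hj y r μ]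
  by_cases h1 : y ν = -1 <;> by_cases h2 : y μ = -1 <;> simp [h1, h2]

/-! ## §3 One step: the standard form reproduces itself under the (0.4) linear average -/

/-- Summing a function of the second component over a product multiplies by the cardinality of the first factor. [folklore] -/
theorem sum_prod_snd_const {α β : Type*} [Fintype α] [Fintype β] (g : β → ℝ) :
    ∑ e : α × β, g e.2 = (Fintype.card α : ℝ) * ∑ b, g b := by
  rw [Fintype.sum_prod_type]
  dsimp only
  rw [Finset.sum_const, Finset.card_univ, nsmul_eq_mul]

/-- **★★ ONE STEP**: if `curl_{μν} a = q·(c − E⁽ʲ⁾_{μν})` at every fine site then `curl_{μν}(linAvg04 a) = q·(L²c − E⁽ʲ⁺¹⁾_{μν})` at every coarse site (exact Stokes ✓`curlAt_linAvg04_eq_sum`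
+ the square count; the `(d!)²·L^d` orderings∕offsets of the (0.4) index set all see the same count). [cite: Balaban1987RG1, (0.4) p.253; Balaban1985Averaging, (14) p.19] -/
theorem curlAt_linAvg04_stdFlux (hj : j + 1 ≤ P.m + P.K) {μ ν : Fin P.d} (hμν : μ ≠ ν) (a : PBond P j → ℝ) (q c : ℝ)
    (ha : ∀ x : Site P j, curlAt a x μ ν = q * (c - (if x μ = -1 ∧ x ν = -1 then 1 else 0))) (y : Site P (j + 1)) :
    curlAt (linAvg04 a) y μ ν = q * ((P.L : ℝ) ^ 2 * c - (if y μ = -1 ∧ y ν = -1 then 1 else 0)) := by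
  rw [curlAt_linAvg04_eq_sum]
  simp_rw [ha]
  -- the inner sum over the index `e = ((σ,σ′),(t,s))`: the orderings are idle
  have hinner : ∀ r : Fin P.d → Fin P.L,
      (∑ e : (Equiv.Perm (Fin P.d) × Equiv.Perm (Fin P.d)) × (Fin P.L × Fin P.L),
        q * (c - (if shiftN (shiftN (offPt y (off r)) ν (e.2.1 : ℕ)) μ (e.2.2 : ℕ) μ = -1 ∧
          shiftN (shiftN (offPt y (off r)) ν (e.2.1 : ℕ)) μ (e.2.2 : ℕ) ν = -1 then 1 else 0))) =
        (Fintype.card (Equiv.Perm (Fin P.d) × Equiv.Perm (Fin P.d)) : ℝ) *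
          (q * ((P.L : ℝ) ^ 2 * c - (if y μ = -1 ∧ y ν = -1 then 1 else 0))) := by
    intro r
    have hts : ∑ t : Fin P.L, ∑ s : Fin P.L,
        q * (c - (if shiftN (shiftN (offPt y (off r)) ν (t : ℕ)) μ (s : ℕ) μ = -1 ∧
          shiftN (shiftN (offPt y (off r)) ν (t : ℕ)) μ (s : ℕ) ν = -1 then (1 : ℝ) else 0)) =
        q * ((P.L : ℝ) ^ 2 * c - (if y μ = -1 ∧ y ν = -1 then 1 else 0)) := by
      have hD := sum_sq_defect hj y r hμν
      have h1 : ∀ t : Fin P.L, ∑ s : Fin P.L,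
          q * (c - (if shiftN (shiftN (offPt y (off r)) ν (t : ℕ)) μ (s : ℕ) μ = -1 ∧
            shiftN (shiftN (offPt y (off r)) ν (t : ℕ)) μ (s : ℕ) ν = -1 then (1 : ℝ) else 0)) =
          q * ((P.L : ℝ) * c - ∑ s : Fin P.L, (if shiftN (shiftN (offPt y (off r)) ν (t : ℕ)) μ (s : ℕ) μ = -1 ∧
            shiftN (shiftN (offPt y (off r)) ν (t : ℕ)) μ (s : ℕ) ν = -1 then (1 : ℝ) else 0)) := by
        intro t
        rw [← Finset.mul_sum, Finset.sum_sub_distrib, Finset.sum_const, Finset.card_univ, Fintype.card_fin, nsmul_eq_mul]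
      rw [Finset.sum_congr rfl (fun t _ => h1 t), ← Finset.mul_sum, Finset.sum_sub_distrib, Finset.sum_const, Finset.card_univ,
        Fintype.card_fin, nsmul_eq_mul, hD]
      ring
    have hsp := sum_prod_snd_const (α := Equiv.Perm (Fin P.d) × Equiv.Perm (Fin P.d))
      (fun ts : Fin P.L × Fin P.L => q * (c - (if shiftN (shiftN (offPt y (off r)) ν (ts.1 : ℕ)) μ (ts.2 : ℕ) μ = -1 ∧
          shiftN (shiftN (offPt y (off r)) ν (ts.1 : ℕ)) μ (ts.2 : ℕ) ν = -1 then (1 : ℝ) else 0)))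
    refine hsp.trans ?_
    congr 1
    rw [Fintype.sum_prod_type]
    exact hts
  simp_rw [hinner]
  simp only [Finset.sum_const, Finset.card_univ, nsmul_eq_mul]
  have hcard : (Fintype.card (Idx P) : ℝ) = (Fintype.card (Fin P.d → Fin P.L) : ℝ) * (Fintype.card (Equiv.Perm (Fin P.d) × Equiv.Perm (Fin P.d)) : ℝ) := by
    have h : Fintype.card (Idx P) = Fintype.card (Fin P.d → Fin P.L) * Fintype.card (Equiv.Perm (Fin P.d) × Equiv.Perm (Fin P.d)) :=
      Fintype.card_prod _ _
    rw [h]; push_cast; ring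
  have hpos : (0 : ℝ) < Fintype.card (Idx P) := by exact_mod_cast Fintype.card_pos
  rw [hcard] at hpos ⊢
  field_simp

/-! ## §4 Iteration from the finest level -/

/-- **★★ ITERATED STANDARD FORM**: `curl_{μν}(linAvgIter s a) = q·((L²)^s·c − E⁽ˢ⁾_{μν})` for `s ≤ m + K`. [cite: Balaban1987RG1, (0.11) p.253] -/
theorem curlAt_linAvgIter_stdFlux {μ ν : Fin P.d} (hμν : μ ≠ ν) (a : PBond P 0 → ℝ) (q c : ℝ)
    (ha : ∀ x : Site P 0, curlAt a x μ ν = q * (c - (if x μ = -1 ∧ x ν = -1 then 1 else 0))) :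
    ∀ (s : ℕ), s ≤ P.m + P.K → ∀ y : Site P s, curlAt (linAvgIter s a) y μ ν = q * (((P.L : ℝ) ^ 2) ^ s * c - (if y μ = -1 ∧ y ν = -1 then 1 else 0))
  | 0, _, y => by simpa [linAvgIter] using ha y
  | s + 1, hs, y => by
    rw [linAvgIter_succ, curlAt_linAvg04_stdFlux (by omega) hμν (linAvgIter s a) q (((P.L : ℝ) ^ 2) ^ s * c)
      (fun x => curlAt_linAvgIter_stdFlux hμν a q c ha s (by omega) x) y, pow_succ]
    ring

/-- A vanishing curl component stays vanishing under the iterated average (the case `q = 0`). [cite: Balaban1987RG1, (0.11) p.253] -/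
theorem curlAt_linAvgIter_eq_zero {μ ν : Fin P.d} (hμν : μ ≠ ν) (a : PBond P 0 → ℝ) (ha : ∀ x : Site P 0, curlAt a x μ ν = 0) :
    ∀ (s : ℕ), s ≤ P.m + P.K → ∀ y : Site P s, curlAt (linAvgIter s a) y μ ν = 0 := by
  intro s hs y
  have h := curlAt_linAvgIter_stdFlux hμν a 0 0 (fun x => by rw [ha x]; ring) s hs y
  rw [h]; ring

/-- The lattice curl is antisymmetric in the two directions. [cite: Balaban1985Averaging, (9) p.19] -/
theorem curlAt_swap' {i : ℕ} (a : PBond P i → ℝ) (x : Site P i) (μ ν : Fin P.d) : curlAt a x ν μ = -curlAt a x μ ν := by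
  simp only [curlAt]; ring

/-- The diagonal curl component vanishes. [cite: Balaban1985Averaging, (9) p.19] -/
theorem curlAt_self {i : ℕ} (a : PBond P i → ℝ) (x : Site P i) (μ : Fin P.d) : curlAt a x μ μ = 0 := by
  simp only [curlAt]; ring

/-! ## §5 The explicit uniform-flux cochain at the finest level -/

/-- **★ THE UNIFORM-FLUX COCHAIN WITH ONE DIRAC COLUMN**: for `μ ≠ ν` and charge `q` there is a fine one-form `w` with `curl_{μν} w = q·(1/M² − E⁽⁰⁾_{μν})`, `curl_{νμ} w` its negative
and every other curl component zero — explicitly `w(x,ν) = q·x_μ/M²`, `w(x,μ) = −q·[x_μ = −1]·x_ν/M`, `w(x,κ) = 0` otherwise (`M = sitesPerDir 0`, labels `x_κ ∈ [0, M)`).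
[cite: Balaban1985Averaging, (9) p.19] -/
theorem exists_stdFlux_cochain {μ ν : Fin P.d} (hμν : μ ≠ ν) (q : ℝ) :
    ∃ w : PBond P 0 → ℝ, ∀ (x : Site P 0) (κ lam : Fin P.d), curlAt w x κ lam =
      (if κ = μ ∧ lam = ν then (1 : ℝ) else if κ = ν ∧ lam = μ then -1 else 0) *
        (q * (1 / ((P.sitesPerDir 0 : ℝ)) ^ 2 - (if x μ = -1 ∧ x ν = -1 then 1 else 0))) := by
  set M : ℕ := P.sitesPerDir 0 with hM
  have hM1 : 1 < M := P.one_lt_sitesPerDir 0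
  have hM0 : (0 : ℝ) < (M : ℝ) := by exact_mod_cast (by omega : 0 < M)
  let w : PBond P 0 → ℝ := fun b =>
    if b.dir = ν then q * ((b.src μ).val : ℝ) / (M : ℝ) ^ 2
    else if b.dir = μ then (if b.src μ = -1 then -(q * ((b.src ν).val : ℝ) / (M : ℝ)) else 0) else 0
  have hwν : ∀ x : Site P 0, w ⟨x, ν⟩ = q * ((x μ).val : ℝ) / (M : ℝ) ^ 2 := fun x => by simp [w]
  have hwμ : ∀ x : Site P 0, w ⟨x, μ⟩ = if x μ = -1 then -(q * ((x ν).val : ℝ) / (M : ℝ)) else 0 := fun x => by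
    simp [w, hμν]
  have hw0 : ∀ (x : Site P 0) (κ : Fin P.d), κ ≠ μ → κ ≠ ν → w ⟨x, κ⟩ = 0 := fun x κ h1 h2 => by simp [w, h1, h2]
  -- the main component
  have hvneg : ∀ z : ZMod M, z = -1 → ((z.val : ℕ) : ℝ) = (M : ℝ) - 1 := fun z hz => by
    rw [(eq_neg_one_iff_val z).mp hz, Nat.cast_sub hM1.le, Nat.cast_one]
  have hsucc0 : ∀ z : ZMod M, z = -1 → (((z + 1).val : ℕ) : ℝ) = 0 := fun z hz => by
    rw [val_add_one_eq, if_pos hz, Nat.cast_zero]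
  have hsucc1 : ∀ z : ZMod M, z ≠ -1 → (((z + 1).val : ℕ) : ℝ) = (z.val : ℝ) + 1 := fun z hz => by
    rw [val_add_one_eq, if_neg hz, Nat.cast_add, Nat.cast_one]
  have hmain : ∀ x : Site P 0, curlAt w x μ ν = q * (1 / (M : ℝ) ^ 2 - (if x μ = -1 ∧ x ν = -1 then 1 else 0)) := by
    intro x
    have hsμμ : (x.shift μ) μ = x μ + 1 := by rw [Site.shift_apply, if_pos rfl]
    have hsνμ : (x.shift ν) μ = x μ := by rw [Site.shift_apply, if_neg hμν]
    have hsνν : (x.shift ν) ν = x ν + 1 := by rw [Site.shift_apply, if_pos rfl]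
    have hc : curlAt w x μ ν = w ⟨x, μ⟩ + w ⟨x.shift μ, ν⟩ - w ⟨x.shift ν, μ⟩ - w ⟨x, ν⟩ := rfl
    rw [hc, hwμ, hwν, hwμ, hwν, hsμμ, hsνμ, hsνν]
    by_cases h1 : x μ = -1
    · rw [if_pos h1, if_pos h1, hsucc0 _ h1, hvneg _ h1]
      by_cases h2 : x ν = -1
      · rw [if_pos ⟨h1, h2⟩, hsucc0 _ h2, hvneg _ h2]
        field_simp; ring
      · rw [if_neg (fun h => h2 h.2), hsucc1 _ h2]
        field_simp; ring
    · rw [if_neg h1, if_neg h1, if_neg (fun h => h1 h.1), hsucc1 _ h1]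
      field_simp; ring
  -- the mixed components vanish
  have hμlam : ∀ (x : Site P 0) (lam : Fin P.d), lam ≠ μ → lam ≠ ν → curlAt w x μ lam = 0 := by
    intro x lam h1 h2
    have hc : curlAt w x μ lam = w ⟨x, μ⟩ + w ⟨x.shift μ, lam⟩ - w ⟨x.shift lam, μ⟩ - w ⟨x, lam⟩ := rfl
    rw [hc, hw0 _ lam h1 h2, hw0 _ lam h1 h2, hwμ, hwμ]
    have e1 : (x.shift lam) μ = x μ := by rw [Site.shift_apply, if_neg (Ne.symm h1)]
    have e2 : (x.shift lam) ν = x ν := by rw [Site.shift_apply, if_neg (Ne.symm h2)]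
    rw [e1, e2]; split_ifs <;> ring
  have hνlam : ∀ (x : Site P 0) (lam : Fin P.d), lam ≠ μ → lam ≠ ν → curlAt w x ν lam = 0 := by
    intro x lam h1 h2
    have hc : curlAt w x ν lam = w ⟨x, ν⟩ + w ⟨x.shift ν, lam⟩ - w ⟨x.shift lam, ν⟩ - w ⟨x, lam⟩ := rfl
    rw [hc, hw0 _ lam h1 h2, hw0 _ lam h1 h2, hwν, hwν]
    have e1 : (x.shift lam) μ = x μ := by rw [Site.shift_apply, if_neg (Ne.symm h1)]
    rw [e1]; ring
  have hother : ∀ (x : Site P 0) (κ lam : Fin P.d), κ ≠ μ → κ ≠ ν → lam ≠ μ → lam ≠ ν → curlAt w x κ lam = 0 := by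
    intro x κ lam h1 h2 h3 h4
    have hc : curlAt w x κ lam = w ⟨x, κ⟩ + w ⟨x.shift κ, lam⟩ - w ⟨x.shift lam, κ⟩ - w ⟨x, lam⟩ := rfl
    rw [hc, hw0 _ κ h1 h2, hw0 _ lam h3 h4, hw0 _ κ h1 h2, hw0 _ lam h3 h4]; ring
  refine ⟨w, fun x κ lam => ?_⟩
  by_cases hκμ : κ = μ
  · subst hκμ
    by_cases hlν : lam = ν
    · subst hlν; rw [if_pos ⟨rfl, rfl⟩, one_mul, hmain]
    · rw [if_neg (fun h => hlν h.2), if_neg (fun h => hμν h.1), zero_mul]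
      by_cases hlμ : lam = κ
      · subst hlμ; exact curlAt_self w x _
      · exact hμlam x lam hlμ hlν
  · by_cases hκν : κ = ν
    · subst hκν
      rw [if_neg (fun h => hκμ h.1)]
      by_cases hlμ : lam = μ
      · subst hlμ; rw [if_pos ⟨rfl, rfl⟩, curlAt_swap', hmain]; ring
      · rw [if_neg (fun h => hlμ h.2), zero_mul]
        by_cases hlν : lam = κ
        · subst hlν; exact curlAt_self w x _
        · exact hνlam x lam hlμ hlν
    · rw [if_neg (fun h => hκμ h.1), if_neg (fun h => hκν h.1), zero_mul]
      by_cases hlμ : lam = μ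
      · subst hlμ; rw [curlAt_swap', hμlam x κ hκμ hκν]; ring
      · by_cases hlν : lam = ν
        · subst hlν; rw [curlAt_swap', hνlam x κ hκμ hκν]; ring
        · exact hother x κ lam hκμ hκν hlμ hlν

/-! ## §6 The flux lift -/

/-- `(L²)^k / M₀² = 1 / M_k²` (`M₀ = L^k·M_k` in the standing range). [cite: Balaban1987RG1, (0.1) p.251] -/
theorem pow_mul_inv_sq (k : ℕ) (hk : k ≤ P.m + P.K) :
    ((P.L : ℝ) ^ 2) ^ k * (1 / ((P.sitesPerDir 0 : ℝ)) ^ 2) = 1 / ((P.sitesPerDir k : ℝ)) ^ 2 := by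
  have h0 : (P.sitesPerDir 0 : ℝ) = (P.L : ℝ) ^ k * (P.sitesPerDir k : ℝ) := by
    rw [hN k hk, hside]; push_cast; ring
  have hL : (0 : ℝ) < (P.L : ℝ) := by exact_mod_cast P.L_pos
  have hMk : (0 : ℝ) < (P.sitesPerDir k : ℝ) := by exact_mod_cast (by have := P.one_lt_sitesPerDir k; omega)
  rw [h0]
  field_simp
  ring

/-- **★★★ «FLUX-LIFT»**: for every direction pair `μ ≠ ν` and charge `q ∈ ℤ` there are a FINE one-form `w` on `T_η` and a COARSE one-form `W` on `T^{(k)}` with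
(E) `linAvgIter k w = W` EXACTLY; (F₀) `curl w = sgn·q·(1/M₀² − E⁽⁰⁾_{μν})` — uniform flux `q/M₀²` per `(μν)`-plaquette minus the INTEGER defect `q` on the one plaquette per
`(μν)`-layer with `x_μ = x_ν = −1`, every other component zero; (F_k) `curl W = sgn·q·(1/M_k² − E⁽ᵏ⁾_{μν})` — the same standard form on the coarse torus.  (`sgn = 1, −1, 0`
for `(κ,λ) = (μ,ν), (ν,μ)`, otherwise.) [cite: Balaban1987RG1, (0.4)+(0.11) p.253; Balaban1985Averaging, (9)+(14) p.19] -/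
theorem exists_fluxLift (k : ℕ) (hk : k ≤ P.m + P.K) {μ ν : Fin P.d} (hμν : μ ≠ ν) (q : ℤ) :
    ∃ (w : PBond P 0 → ℝ) (W : PBond P k → ℝ), linAvgIter k w = W ∧
      (∀ (x : Site P 0) (κ lam : Fin P.d), curlAt w x κ lam =
        (if κ = μ ∧ lam = ν then (1 : ℝ) else if κ = ν ∧ lam = μ then -1 else 0) *
          ((q : ℝ) * (1 / ((P.sitesPerDir 0 : ℝ)) ^ 2 - (if x μ = -1 ∧ x ν = -1 then 1 else 0)))) ∧
      (∀ (y : Site P k) (κ lam : Fin P.d), curlAt W y κ lam =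
        (if κ = μ ∧ lam = ν then (1 : ℝ) else if κ = ν ∧ lam = μ then -1 else 0) *
          ((q : ℝ) * (1 / ((P.sitesPerDir k : ℝ)) ^ 2 - (if y μ = -1 ∧ y ν = -1 then 1 else 0)))) := by
  obtain ⟨w, hw⟩ := exists_stdFlux_cochain (P := P) hμν (q : ℝ)
  refine ⟨w, linAvgIter k w, rfl, hw, fun y κ lam => ?_⟩
  -- the `(μ,ν)` component in standard form, iterated
  have hmain : curlAt (linAvgIter k w) y μ ν = (q : ℝ) * (1 / ((P.sitesPerDir k : ℝ)) ^ 2 - (if y μ = -1 ∧ y ν = -1 then 1 else 0)) := by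
    have h := curlAt_linAvgIter_stdFlux hμν w (q : ℝ) (1 / ((P.sitesPerDir 0 : ℝ)) ^ 2)
      (fun x => by rw [hw x μ ν, if_pos ⟨rfl, rfl⟩, one_mul]) k hk y
    rw [h, pow_mul_inv_sq k hk]
  by_cases hκμ : κ = μ
  · subst hκμ
    by_cases hlν : lam = ν
    · subst hlν; rw [if_pos ⟨rfl, rfl⟩, one_mul, hmain]
    · rw [if_neg (fun h => hlν h.2), if_neg (fun h => hμν h.1), zero_mul]
      by_cases hlμ : lam = κ
      · subst hlμ; exact curlAt_self _ y _
      · exact curlAt_linAvgIter_eq_zero (fun h => hlμ h.symm) w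
          (fun x => by rw [hw x κ lam, if_neg (fun h => hlν h.2), if_neg (fun h => hμν h.1), zero_mul]) k hk y
  · by_cases hκν : κ = ν
    · subst hκν
      rw [if_neg (fun h => hκμ h.1)]
      by_cases hlμ : lam = μ
      · subst hlμ; rw [if_pos ⟨rfl, rfl⟩, curlAt_swap', hmain]; ring
      · rw [if_neg (fun h => hlμ h.2), zero_mul]
        by_cases hlν : lam = κ
        · subst hlν; exact curlAt_self _ y _
        · have hz := curlAt_linAvgIter_eq_zero (Ne.symm hlν) w
            (fun x => by rw [hw x κ lam, if_neg (fun h => hκμ h.1), if_neg (fun h => hlμ h.2), zero_mul]) k hk y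
          exact hz
    · rw [if_neg (fun h => hκμ h.1), if_neg (fun h => hκν h.1), zero_mul]
      by_cases hlκ : lam = κ
      · subst hlκ; exact curlAt_self _ y _
      · exact curlAt_linAvgIter_eq_zero (Ne.symm hlκ) w
          (fun x => by rw [hw x κ lam, if_neg (fun h => hκμ h.1), if_neg (fun h => hκν h.1), zero_mul]) k hk y

end Summit.QuantumFields.YangMills.Theorems.LinearLiftFlux

end
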